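import Literature.Geometry.Lorentzian.AsymptoticFlatnessChart
import HarnessLib

/-!
# Two structures at infinity of the same end: the transition map

Support file (all results proved) for Bartnik's uniqueness theorem for the ADM energy
(`AFEnd.HasADMEnergy.Of_isSameEnd`, Bartnik, CPAM 39 (1986), Cor. 3.2 and Thm. 4.2). For two end
structures `e`, `e'` of a `3`-manifold `X` (charts `e.chart : e.U ≅ {R < ‖x‖}`,
`e'.chart : e'.U ≅ {R' < ‖y‖}`) we set up, as honest maps between Euclidean spaces,

* `AFEnd.chartExt e : X → E3` — the chart extended by the junk value `0` off `e.U`;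
* `AFEnd.dataChartTotal e : E3 → X` — the inverse chart `Φ` extended by a junk value inside the ball;
* `AFEnd.transition e e' : E3 → E3`, `y ↦ e.chartExt (e'.dataChartTotal y)` — the **transition map**
  `x = G(y)` expressing the coordinates of `e` through those of `e'` (junk where undefined),

and prove: the metric components are `hCoeff e D x (v, w) = h_{Φ x}(dΦₓ v, dΦₓ w)` with the
*unrestricted* differential of `dataChartTotal` (`hCoeff_eq_inner_dataChartTotal`); on the open
**overlap** `{R' < ‖y‖, Φ'(y) ∈ e.U}` the transition map is smooth, `Φ ∘ G = Φ'`, the two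
transition maps are mutually inverse, and the **tensor transformation law**
`h'ᵢⱼ(y) = hₐᵦ(G y) ∂ᵢGᵃ ∂ⱼGᵇ`, i.e. `hCoeff e' D y (v, w) = hCoeff e D (G y) (DG(y) v, DG(y) w)`
(`hCoeff_transition`); finally, if `e`, `e'` describe the same end (`IsSameEnd`), then every
sufficiently far point of the `e'`-chart lies in the overlap and is mapped arbitrarily far out by
`G` (`IsSameEnd.eventually_overlap`). This is the set-up of Bartnik 1986, §3 ("two structures of
infinity `Φ`, `Ψ` … the transition `Φ ∘ Ψ⁻¹` is defined on `E_{R₁}` for `R₁` large").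

Design note: `AsymptoticallyFlatChart.lean` has the analogous total functions `AFEnd.coord`,
`AFEnd.dataChartExt` for a manifold `X : Type` in universe `0` only (and behind heavy imports);
the fact `HasADMEnergy.Of_isSameEnd` is universe polymorphic, so the (short) constructions are
redone here for `X : Type*` under the names `chartExt`, `dataChartTotal`.

## References

* R. Bartnik, *The mass of an asymptotically flat manifold*, CPAM 39 (1986), §3, Cor. 3.2.
* P. T. Chruściel, *Boundary conditions at spatial infinity from a Hamiltonian point of view*
  (1986), §2.
-/

noncomputable section

open Manifold Bundle TopologicalSpace Filter Metric Set
open scoped ContDiff Topology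

namespace Literature.Geometry.Lorentzian

namespace AFEnd

variable {X : Type*} [TopologicalSpace X] [ChartedSpace E3 X]

/-! ### The chart and the inverse chart as maps between `X` and `E3` -/

/-- A base point of the exterior region `{R < ‖x‖}`: the point `(R + 1) e₀`. [folklore] -/
def basePoint (e : AFEnd X) : exteriorRegion e.R :=
  ⟨EuclideanSpace.single 0 (e.R + 1), by
    change e.R < ‖EuclideanSpace.single (0 : Fin 3) (e.R + 1)‖
    rw [PiLp.norm_single, Real.norm_eq_abs, abs_of_pos (by linarith [e.R_pos])]
    linarith⟩

open scoped Classical in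
/-- The chart of the end extended to all of `X` (junk value `0` off the end `U`):
`chartExt p = e.chart p ∈ E3` for `p ∈ U`. Bartnik 1986, §1 (the structure of infinity `Φ`).
[cite: Bartnik1986, §1] -/
def chartExt (e : AFEnd X) (p : X) : E3 :=
  if hp : p ∈ e.U then ((e.chart ⟨p, hp⟩ : exteriorRegion e.R) : E3) else 0

/-- The inverse chart of the end extended to all of `E3` (junk value `Φ((R+1)e₀)` inside the
closed ball `‖x‖ ≤ R`): `dataChartTotal x = Φ(x)` for `R < ‖x‖`. Bartnik 1986, §1. [cite: Bartnik1986, §1] -/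
def dataChartTotal (e : AFEnd X) (x : E3) : X :=
  if hx : e.R < ‖x‖ then e.dataChart ⟨x, hx⟩ else e.dataChart e.basePoint

/-- The **transition map** between two structures at infinity: `transition e e' y =
e.chartExt (e'.dataChartTotal y)`, i.e. the `e`-coordinates `x = G(y)` of the point with
`e'`-coordinates `y` (junk where this point is not in `e.U` or `‖y‖ ≤ R'`). Bartnik 1986, §3
(`Φ ∘ Ψ⁻¹`). [cite: Bartnik1986, §3] -/
def transition (e e' : AFEnd X) (y : E3) : E3 :=
  e.chartExt (e'.dataChartTotal y)

/-- The **overlap** of the two structures, read in the `e'`-chart: the points `y`, `R' < ‖y‖`,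
whose image `Φ'(y)` lies in the end `e.U`. Bartnik 1986, §3. [cite: Bartnik1986, §3] -/
def overlap (e e' : AFEnd X) : Set E3 :=
  {y | e'.R < ‖y‖ ∧ e'.dataChartTotal y ∈ e.U}

variable {e e' : AFEnd X}

/-- On the end, `chartExt` is the chart. [folklore] -/
theorem chartExt_of_mem {p : X} (hp : p ∈ e.U) :
    e.chartExt p = ((e.chart ⟨p, hp⟩ : exteriorRegion e.R) : E3) := by
  classical
  exact dif_pos hp

/-- Outside the ball, `dataChartTotal` is the inverse chart. [folklore] -/
theorem dataChartTotal_of_lt {x : E3} (hx : e.R < ‖x‖) : e.dataChartTotal x = e.dataChart ⟨x, hx⟩ :=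
  dif_pos hx

/-- The inverse chart is the restriction of `dataChartTotal`. [folklore] -/
theorem dataChart_eq_dataChartTotal (u : exteriorRegion e.R) : e.dataChart u = e.dataChartTotal u := by
  rw [dataChartTotal_of_lt u.2]

/-- `dataChartTotal` takes values in the end `U`. [folklore] -/
theorem dataChartTotal_mem (x : E3) : e.dataChartTotal x ∈ e.U := by
  unfold dataChartTotal
  split_ifs <;> exact (e.chart.symm _).2

/-- `chartExt ∘ Φ = id` on the exterior region: `chartExt (Φ u) = u`. [folklore] -/
theorem chartExt_dataChart (u : exteriorRegion e.R) : e.chartExt (e.dataChart u) = u := by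
  have hp : e.dataChart u ∈ e.U := (e.chart.symm u).2
  rw [chartExt_of_mem hp]
  have : (⟨e.dataChart u, hp⟩ : e.U) = e.chart.symm u := rfl
  rw [this, e.chart.apply_symm_apply]

/-- `chartExt (dataChartTotal x) = x` for `R < ‖x‖`. [folklore] -/
theorem chartExt_dataChartTotal {x : E3} (hx : e.R < ‖x‖) : e.chartExt (e.dataChartTotal x) = x := by
  rw [dataChartTotal_of_lt hx, chartExt_dataChart]

/-- The extended chart maps the end into the exterior region: `R < ‖chartExt p‖` for `p ∈ U`.
[folklore] -/
theorem lt_norm_chartExt {p : X} (hp : p ∈ e.U) : e.R < ‖e.chartExt p‖ := by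
  rw [chartExt_of_mem hp]
  exact (e.chart ⟨p, hp⟩).2

/-- `Φ ∘ chartExt = id` on the end: `dataChartTotal (chartExt p) = p` for `p ∈ U`. [folklore] -/
theorem dataChartTotal_chartExt {p : X} (hp : p ∈ e.U) : e.dataChartTotal (e.chartExt p) = p := by
  rw [dataChartTotal_of_lt (lt_norm_chartExt hp)]
  have h1 : (⟨e.chartExt p, lt_norm_chartExt hp⟩ : exteriorRegion e.R) = e.chart ⟨p, hp⟩ :=
    Subtype.ext (chartExt_of_mem hp)
  rw [h1]
  change ((e.chart.symm (e.chart ⟨p, hp⟩) : e.U) : X) = p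
  rw [e.chart.symm_apply_apply]

/-- The extended chart is smooth at the points of the end. [folklore] -/
theorem contMDiffAt_chartExt {p : X} (hp : p ∈ e.U) : ContMDiffAt (𝓡 3) 𝓘(ℝ, E3) ∞ e.chartExt p := by
  have key : ContMDiffAt (𝓡 3) 𝓘(ℝ, E3) ∞ (fun q : e.U ↦ e.chartExt (q : X)) ⟨p, hp⟩ := by
    have hfun : (fun q : e.U ↦ e.chartExt (q : X)) =
        fun q : e.U ↦ ((e.chart q : exteriorRegion e.R) : E3) := by
      funext q
      rw [chartExt_of_mem q.2]
    rw [hfun]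
    exact (contMDiff_subtype_val.comp e.chart.contMDiff) _
  exact contMDiffAt_subtype_iff.1 key

/-- The extended inverse chart is smooth outside the ball. [folklore] -/
theorem contMDiffAt_dataChartTotal {x : E3} (hx : e.R < ‖x‖) :
    ContMDiffAt 𝓘(ℝ, E3) (𝓡 3) ∞ e.dataChartTotal x := by
  have key : ContMDiffAt 𝓘(ℝ, E3) (𝓡 3) ∞ (fun u : exteriorRegion e.R ↦ e.dataChartTotal (u : E3))
      ⟨x, hx⟩ := by
    have hfun : (fun u : exteriorRegion e.R ↦ e.dataChartTotal (u : E3)) = e.dataChart :=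
      funext fun u ↦ (dataChart_eq_dataChartTotal u).symm
    rw [hfun]
    exact e.contMDiff_dataChart _
  exact contMDiffAt_subtype_iff.1 key

/-- The extended inverse chart is continuous on the open exterior region. [folklore] -/
theorem continuousOn_dataChartTotal : ContinuousOn e.dataChartTotal {x : E3 | e.R < ‖x‖} :=
  fun _ hx ↦ (contMDiffAt_dataChartTotal hx).continuousAt.continuousWithinAt

/-- **The differential of the inverse chart is that of its extension**: for `u` in the exterior
region, `dΦ_u = d(dataChartTotal)_u` (the inclusion of the open set has the identity as
differential). [folklore] -/
theorem mfderiv_dataChart_eq_total (u : exteriorRegion e.R) (v : E3) :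
    mfderiv (𝓡 3) (𝓡 3) e.dataChart u v = mfderiv 𝓘(ℝ, E3) (𝓡 3) e.dataChartTotal u v := by
  have hfun : e.dataChart = e.dataChartTotal ∘ (Subtype.val : exteriorRegion e.R → E3) :=
    funext fun u ↦ dataChart_eq_dataChartTotal u
  have hval : mfderiv (𝓡 3) (𝓡 3) (Subtype.val : exteriorRegion e.R → E3) u =
      ContinuousLinearMap.id ℝ E3 := by
    have := OpensChart.mfderiv_eq (U := exteriorRegion e.R) (F := E3) u Subtype.val id
      (fun _ ↦ rfl) differentiableAt_id
    rw [fderiv_id] at this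
    exact this
  have hd1 : MDifferentiableAt 𝓘(ℝ, E3) (𝓡 3) e.dataChartTotal ((Subtype.val : _ → E3) u) :=
    (contMDiffAt_dataChartTotal u.2).mdifferentiableAt (by simp)
  have hd2 : MDifferentiableAt (𝓡 3) (𝓡 3) (Subtype.val : exteriorRegion e.R → E3) u :=
    ((contMDiff_subtype_val (n := ∞)) u).mdifferentiableAt (by simp)
  rw [hfun, mfderiv_comp u hd1 hd2, hval]
  rfl

/-! ### The metric components through the extended inverse chart -/

section Metric

variable [IsManifold (𝓡 3) ∞ X] (D : InitialDataSet (𝓡 3) X)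

/-- Transport of `h_p(v, w)` along an equality of base points (the tangent spaces are all the
model space `E3`). [folklore] -/
theorem inner_congr_point {p q : X} (h : p = q) (v w : E3) : D.h.inner p v w = D.h.inner q v w := by
  subst h
  rfl

/-- **The metric components through the extended inverse chart**: for `R < ‖x‖`,
`hCoeff e D x (v, w) = h_{Φ x}(dΦₓ v, dΦₓ w)` with `Φ = dataChartTotal e` and its unrestricted
manifold differential. Bartnik 1986, (1.3). [cite: Bartnik1986, §1, (1.3)] -/
theorem hCoeff_eq_inner_dataChartTotal {x : E3} (hx : e.R < ‖x‖) (v w : E3) :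
    hCoeff e D x v w = D.h.inner (e.dataChartTotal x)
      (mfderiv 𝓘(ℝ, E3) (𝓡 3) e.dataChartTotal x v) (mfderiv 𝓘(ℝ, E3) (𝓡 3) e.dataChartTotal x w) := by
  rw [hCoeff_of_lt D hx]
  change D.h.inner (e.dataChart ⟨x, hx⟩) (mfderiv (𝓡 3) (𝓡 3) e.dataChart ⟨x, hx⟩ v)
    (mfderiv (𝓡 3) (𝓡 3) e.dataChart ⟨x, hx⟩ w) = _
  rw [mfderiv_dataChart_eq_total, mfderiv_dataChart_eq_total]
  exact inner_congr_point D (dataChart_eq_dataChartTotal ⟨x, hx⟩) _ _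

end Metric

/-! ### The transition map -/

/-- The overlap is open. [folklore] -/
theorem isOpen_overlap : IsOpen (overlap e e') :=
  continuousOn_dataChartTotal.isOpen_inter_preimage (isOpen_lt continuous_const continuous_norm)
    e.U.isOpen

/-- On the overlap, `Φ ∘ G = Φ'`. Bartnik 1986, §3. [cite: Bartnik1986, §3] -/
theorem dataChartTotal_transition {y : E3} (hy : y ∈ overlap e e') :
    e.dataChartTotal (transition e e' y) = e'.dataChartTotal y :=
  dataChartTotal_chartExt hy.2

/-- On the overlap, the transition map lands in the exterior region of `e`. [folklore] -/
theorem lt_norm_transition {y : E3} (hy : y ∈ overlap e e') : e.R < ‖transition e e' y‖ :=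
  lt_norm_chartExt hy.2

/-- On the overlap, `Φ' = Φ ∘ G` near every point. [folklore] -/
theorem dataChartTotal_eventuallyEq {y : E3} (hy : y ∈ overlap e e') :
    e'.dataChartTotal =ᶠ[𝓝 y] e.dataChartTotal ∘ transition e e' := by
  filter_upwards [isOpen_overlap.mem_nhds hy] with z hz
  exact (dataChartTotal_transition hz).symm

/-- **The transition map is smooth on the overlap.** Bartnik 1986, §3. [cite: Bartnik1986, §3] -/
theorem contDiffAt_transition {y : E3} (hy : y ∈ overlap e e') :
    ContDiffAt ℝ ∞ (transition e e') y := by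
  have h : ContMDiffAt 𝓘(ℝ, E3) 𝓘(ℝ, E3) ∞ (transition e e') y :=
    (contMDiffAt_chartExt hy.2).comp y (contMDiffAt_dataChartTotal hy.1)
  exact contMDiffAt_iff_contDiffAt.1 h

/-- The image of an overlap point lies in the opposite overlap. [folklore] -/
theorem transition_mem_overlap {y : E3} (hy : y ∈ overlap e e') :
    transition e e' y ∈ overlap e' e := by
  refine ⟨lt_norm_transition hy, ?_⟩
  rw [dataChartTotal_transition hy]
  exact dataChartTotal_mem y

/-- **The two transition maps are mutually inverse on the overlap**: `G'(G(y)) = y`.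
Bartnik 1986, §3. [cite: Bartnik1986, §3] -/
theorem transition_transition {y : E3} (hy : y ∈ overlap e e') :
    transition e' e (transition e e' y) = y := by
  unfold transition
  rw [dataChartTotal_chartExt hy.2, chartExt_dataChartTotal hy.1]

/-- **The tensor transformation law** `h'ᵢⱼ(y) = hₐᵦ(G y) ∂ᵢGᵃ ∂ⱼGᵇ`: on the overlap,
`hCoeff e' D y (v, w) = hCoeff e D (G y) (DG(y) v, DG(y) w)` with `G = transition e e'` (both sides
are `h(dΦ' v, dΦ' w)` at the point `Φ'(y) = Φ(G y)`, and `dΦ' = dΦ ∘ DG` by the chain rule).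
Bartnik 1986, §3, proof of Cor. 3.2. [cite: Bartnik1986, §3, Cor. 3.2] -/
theorem hCoeff_transition [IsManifold (𝓡 3) ∞ X] (D : InitialDataSet (𝓡 3) X) {y : E3}
    (hy : y ∈ overlap e e') (v w : E3) :
    hCoeff e' D y v w = hCoeff e D (transition e e' y)
      (fderiv ℝ (transition e e') y v) (fderiv ℝ (transition e e') y w) := by
  have hG : MDifferentiableAt 𝓘(ℝ, E3) 𝓘(ℝ, E3) (transition e e') y :=
    (contMDiffAt_iff_contDiffAt.2 (contDiffAt_transition hy)).mdifferentiableAt (by simp)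
  have hΦ : MDifferentiableAt 𝓘(ℝ, E3) (𝓡 3) e.dataChartTotal (transition e e' y) :=
    (contMDiffAt_dataChartTotal (lt_norm_transition hy)).mdifferentiableAt (by simp)
  have hd : ∀ u : E3, mfderiv 𝓘(ℝ, E3) (𝓡 3) e'.dataChartTotal y u =
      mfderiv 𝓘(ℝ, E3) (𝓡 3) e.dataChartTotal (transition e e' y)
        (fderiv ℝ (transition e e') y u) := by
    intro u
    rw [(dataChartTotal_eventuallyEq hy).mfderiv_eq, mfderiv_comp y hΦ hG, mfderiv_eq_fderiv]
    rfl
  rw [hCoeff_eq_inner_dataChartTotal D hy.1, hCoeff_eq_inner_dataChartTotal D (lt_norm_transition hy),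
    hd v, hd w]
  exact inner_congr_point D (dataChartTotal_transition hy).symm _ _

/-! ### Same end: far points lie in the overlap and go far -/

/-- **Two structures of the same end overlap far out.** If `e`, `e'` describe the same end, then
for every `R₂` there is `R₁` such that every `y` with `R₁ < ‖y‖` lies in the overlap and
`R₂ < ‖G(y)‖`: the far region `e'.far R₁` is contained in `e.far R₂`. Bartnik 1986, §3 (the
transition is defined on `E_{R₁}` and proper). [cite: Bartnik1986, §3] -/
theorem IsSameEnd.eventually_overlap (h : IsSameEnd e e') (R₂ : ℝ) :
    ∃ R₁ : ℝ, e'.R ≤ R₁ ∧ ∀ y : E3, R₁ < ‖y‖ →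
      y ∈ overlap e e' ∧ R₂ < ‖transition e e' y‖ := by
  obtain ⟨R₁, hR₁⟩ := h.2 R₂
  refine ⟨max R₁ e'.R, le_max_right _ _, fun y hy ↦ ?_⟩
  have hy' : e'.R < ‖y‖ := lt_of_le_of_lt (le_max_right _ _) hy
  have hmem : e'.dataChartTotal y ∈ e'.far R₁ := by
    rw [dataChartTotal_of_lt hy']
    exact ⟨e'.chart.symm ⟨y, hy'⟩, by
      change R₁ < ‖((e'.chart (e'.chart.symm ⟨y, hy'⟩) : exteriorRegion e'.R) : E3)‖
      rw [e'.chart.apply_symm_apply]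
      exact lt_of_le_of_lt (le_max_left _ _) hy, rfl⟩
  obtain ⟨q, hq, hqy⟩ := hR₁ hmem
  -- `q : e.U` with `R₂ < ‖e.chart q‖` and `(q : X) = Φ'(y)`
  have hU : e'.dataChartTotal y ∈ e.U := by
    rw [← hqy]
    exact q.2
  refine ⟨⟨hy', hU⟩, ?_⟩
  have hq' : (⟨e'.dataChartTotal y, hU⟩ : e.U) = q := Subtype.ext hqy.symm
  unfold transition
  rw [chartExt_of_mem hU, hq']
  exact hq

end AFEnd

end Literature.Geometry.Lorentzian

end
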